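import Summits.BirchSwinnertonDyer.BirchSwinnertonDyer.Theorems.Rank1ResidualJetKolyvaginLocalTerm
import Literature.NumberTheory.EllipticCurves.HeegnerPointsKolyvaginExceptionalSelmerProofs
import HarnessLib

/-!
# T1 JET (cell `bsd-jet`), road K: the LOCAL PRINT-TO-TYPE input `hloc` of the end forms, as a
# CLOSED statement, from the named Poitou–Tate fact

HONEST FRAMING (programme file `BSD-LIT2PART-PROGRAMME-v1.md` §HONESTY, verbatim): «no tranche here
proves BSD; ARM L moves the LITERAL column of an r ≤ 1 census into the kernel-proved-modulo-named-print
column; ARM P changes what «named print» is worth.» THEOREMS ONLY (seat `bsd-jet-pv-1`, session g6;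
`--supports stmt-BirchSwinnertonDyer-14418`, helper): no definition, no named fact, no `sorry`.
Nothing is booked; 0 classes move.

## What

The end forms of the road-K kernel line — `JET.jetchevDivisibilityCarrierMult_of_localFacts`,
`…CarrierAdd…`, `…CarrierNe…` (pv-2) — take the Kolyvagin-prime local term as a CLOSED,
universally quantified hypothesis `hloc` (classified there as «LOCAL PRINT-TO-TYPE, Jetchev Lemma 5.2
∕ Howard 2004 Prop. 2.1.7»). `kolyvaginLocalTerm_of_poitouTate` proves that closed statement
VERBATIM from the named fact `∀ K, poitouTate_selmerStructure_duality_conj K` (the end forms'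
hypothesis `hPT`), by `GlobalDuality.relIndex_kummer_ker_conjActPlace_eq_pow` (this seat, g6) with
`τ² = 1` (`mul_self_eq_one_of_isImaginaryQuadratic`) and `E[p^k]` finite. So in the end forms `hloc`
is no longer an input: it is `kolyvaginLocalTerm_of_poitouTate hPT`.

References (locators only; no cited FACT is declared): [cite: Jetchev2008, §3.2 (2)–(3), Prop. 4.2,
Lemma 5.2 (i) (p. 822)] [cite: MilneADT2006, Ch. I, Cor. 2.3, Thm. 4.10(b)]. Design: no
definitions. Axioms: `propext`, `Classical.choice`, `Quot.sound`.
-/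

set_option autoImplicit false

noncomputable section

open scoped Classical
open WeierstrassCurve Field NumberField IsDedekindDomain
open Literature.NumberTheory.EllipticCurves Literature.NumberTheory.GaloisRepresentations
open Literature.NumberTheory.GaloisCohomology

namespace Summit.BirchSwinnertonDyer.Rank1Residual.JET

/-- **The closed local input `hloc` of the end forms, from Poitou–Tate.** For every globally minimal
elliptic `W/ℚ`, imaginary quadratic `K` with `τ ≠ 1`, odd prime `p`, `1 ≤ k ≤ M(ℓ)` at a Kolyvagin
prime `ℓ` of W. Zhang, place `v ∋ ℓ` with `hfix : τ • v = v`, and `s = ±1`: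
`(Kum_v).relIndex (ker(conjActPlace W τ (p^k) hfix − s)) = p^k` — the `s`-parts of
`H¹(K_λ, E[p^k])/H¹_f` and of `H¹_f` both have `p^k` elements (Jetchev 2008 §3.2 (2)–(3), Prop. 4.2,
as used in the proof of Lemma 5.2 (i)), GIVEN the named fact `poitouTate_selmerStructure_duality_conj`
(local Tate duality with a conjugation-compatible perfect family). This is the hypothesis `hloc` of
`jetchevDivisibilityCarrierMult_of_localFacts` / `…Add…` / `…Ne…` verbatim.
[cite: Jetchev2008, §3.2 (2)–(3) (p. 815), Prop. 4.2, Lemma 5.2 (i) (p. 822)]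
[cite: MilneADT2006, Ch. I, Cor. 2.3] -/
theorem kolyvaginLocalTerm_of_poitouTate
    (hPT : ∀ (K : Type) [Field K] [NumberField K], poitouTate_selmerStructure_duality_conj K) :
    ∀ (W : WeierstrassCurve ℚ) [W.IsElliptic] [W.IsGloballyMinimal]
      (K : Type) [Field K] [NumberField K], IsImaginaryQuadratic K →
      ∀ (τ : K ≃ₐ[ℚ] K), τ ≠ 1 → ∀ (p k : ℕ) [Fact p.Prime], p ≠ 2 → 1 ≤ k →
      ∀ (ℓ : ℕ), Zhang2014.IsKolyvaginPrime (W.conductorNorm ℤ) W K p ℓ →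
        k ≤ Zhang2014.kolyvaginIndex W p ℓ →
      ∀ (v : HeightOneSpectrum (𝓞 K)), (ℓ : 𝓞 K) ∈ v.asIdeal → ∀ (hfix : τ • v = v)
        (s : ℤ), s = 1 ∨ s = -1 →
      ((W.baseChange K).kummerSelmerStructure ((p ^ k : ℕ) : ℤ) (Sum.inr v)).relIndex
        ((conjActPlace W τ ((p ^ k : ℕ) : ℤ) hfix - s • AddMonoidHom.id _).ker) = p ^ k := by
  intro W _ _ K _ _ hK τ hτ p k _ hp2 hk ℓ hℓ hkℓ v hv hfix s hs
  have hp : p.Prime := Fact.out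
  haveI : Finite (geomTorsion (W.baseChange K) ((p ^ k : ℕ) : ℤ)) :=
    finite_torsionPoints_holds (W.baseChange K) (AlgebraicClosure K)
      (by exact_mod_cast pow_ne_zero k hp.ne_zero)
  exact GlobalDuality.relIndex_kummer_ker_conjActPlace_eq_pow W K hK (hPT K) hp2 hτ
    (mul_self_eq_one_of_isImaginaryQuadratic hK τ) hk ℓ hℓ hkℓ v hv hfix s hs

end Summit.BirchSwinnertonDyer.Rank1Residual.JET

end
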